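import Summits.ValiantsHypothesis.ValiantsHypothesis.Theorems.KPlusLogSqLawTropicalBMarkedEdgeCorePairs

/-!
# Route «KPlusLogSqLaw», crux `TropicalB` (stmt-ValiantsHypothesis-19771) — MARKED-EDGE sector, NESTED-TRIANGLE CORE, ALL sizes, part 3:
# Z-RIGIDITY — inside `σX ⊎ σY ⊎ σZ` the cover of pattern {b0,b4} is the ONLY cover fixing `b0` and `b4`

HONEST FRAMING.  Helper file (cell `pub-symmetroid`, seat val-sym-trop-p4 (g18), 2026-08-28; `--supports stmt-ValiantsHypothesis-19771 --as
helper`).  Continues parts 1–2 (`…MarkedEdgeCorePairs`, `…MarkedEdgeCoreZPairs`): all-`m` structure of a would-be realisation of the nested-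
triangle core {1,2},{1,3},{2,3},{0,4} (kernel-impossible at m = 6, p664896; located-exact impossible m ≤ 8; OPEN for m ≥ 9).  This part is the
all-`m` content of the commonest THREE-BODY Karamata certificates of the lineage (g17 memo §2: `C⊎E⊎Z = T₀⊎T₈⊎T₃₁`, types (0,8,31), (1,8,30),
(0,15,24), …): they all say that some cover other than `σZ` uses both loops `b0`, `b4` inside a triple union containing `σZ`.  Setting and
«unique maximiser» verbatim as in part 1 / the four-bit chain (`FourBit.two_factor`, `FourBit.factors_eq`).  Nothing here proves the law;
nothing concerns `TropicalB` in its window, `WeakLifting`, the doors, `MatrixDescartes` (stmt-ValiantsHypothesis-18050) or VP ≠ VNP.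

CONTENTS.  `not_fix_of_perm`, `count_two_contra` (multiplicity bookkeeping in a pointwise factorisation); **`core_CEZ_unique`,
`core_BEZ_unique`, `core_BCZ_unique`**: for each pair `X ≠ Y` of triangle covers, a cover `T` with `T i ∈ {σX i, σY i, σZ i}` for all `i`
and `T b0 = b0`, `T b4 = b4` IS `σZ`.  Proof: complete `T` to a factorisation `(T, M₂, M₃)` of `σX ⊎ σY ⊎ σZ` (Hall); `T` has slope ≥ 17;
if both `M`'s had slope above that of `σX` they would both use the loop at `b3` (resp. `b2`), which occurs only once among `σX, σY, σZ`
outside `T` — so one of them is low, and three-factor rigidity (`factors_eq`) forces `T = σZ`.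
-/

set_option linter.dupNamespace false
set_option autoImplicit false

namespace Summit.ValiantsHypothesis.ValiantsHypothesis.Theorems.KPlusLogSqLaw
namespace MarkedEdge
namespace Core

open Finset

variable {V : Type*} [Fintype V] [DecidableEq V]

omit [Fintype V] in
/-- In a pointwise factorisation `[t, x, y] ~ [p, q, r]`, if `t = v = r` and `p, q ≠ v` then `x, y ≠ v`. [folklore] -/
theorem not_fix_of_perm {t x y p q r v : V} (h : List.Perm [t, x, y] [p, q, r]) (ht : t = v) (hp : p ≠ v) (hq : q ≠ v)
    (hr : r = v) : x ≠ v ∧ y ≠ v := by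
  have hc := h.count_eq v
  subst ht; subst hr
  simp [List.count_cons, hp, hq] at hc
  constructor
  · intro hx; simp [hx] at hc
  · intro hy; simp [hy] at hc

omit [Fintype V] in
/-- In a pointwise factorisation `[t, x, y] ~ [p, q, r]`, `x = y = v` is impossible if `p, r ≠ v`. [folklore] -/
theorem count_two_contra {t x y p q r v : V} (h : List.Perm [t, x, y] [p, q, r]) (hx : x = v) (hy : y = v) (hp : p ≠ v)
    (hr : r ≠ v) : False := by
  have hc := h.count_eq v
  rw [hx, hy] at hc
  simp [List.count_cons, hp, hr] at hc
  by_cases ht : t = v <;> by_cases hq : q = v <;> simp [ht, hq] at hc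

omit [Fintype V] [DecidableEq V] in
/-- rotating a pointwise factorisation: `[t, x, y] → [x, y, t]`. [folklore] -/
theorem perm_rotate {t x y p q r : V} (h : List.Perm [t, x, y] [p, q, r]) : List.Perm [x, y, t] [p, q, r] :=
  ((List.Perm.swap x t [y]).trans (List.Perm.cons x (List.Perm.swap y t []))).symm.trans h

omit [Fintype V] [DecidableEq V] in
/-- rotating a pointwise factorisation: `[t, x, y] → [y, x, t]`. [folklore] -/
theorem perm_rotate' {t x y p q r : V} (h : List.Perm [t, x, y] [p, q, r]) : List.Perm [y, x, t] [p, q, r] :=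
  (List.Perm.swap x y [t]).trans (perm_rotate h)

section Core

variable (ok : V → V → Prop) (w g : V → V → ℤ) (b : Fin 5 → V)

/-- a cover fixing `b0` and `b4` has slope at least 17. [folklore] -/
theorem slope_ge_seventeen (hb : Function.Injective b)
    (hoff : ∀ i j, j ≠ i → g i j = 0) (hmark : ∀ l, g (b l) (b l) = (2 : ℤ) ^ (l : ℕ)) (haux : ∀ i, (∀ l, b l ≠ i) → g i i = 0)
    (T : Equiv.Perm V) (hT0 : T (b 0) = b 0) (hT4 : T (b 4) = b 4) : 17 ≤ ∑ i, g i (T i) := by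
  rw [slope_eq_sum_marked g b hb hoff hmark haux T, Fin.sum_univ_five]
  by_cases c1 : T (b 1) = b 1 <;> by_cases c2 : T (b 2) = b 2 <;> by_cases c3 : T (b 3) = b 3 <;>
    simp [hT0, hT4, c1, c2, c3]

/-- a cover missing the loops at `b0, b4` whose slope exceeds 10 uses the loop at `b2` (and at `b3`). [folklore] -/
theorem fix_two_of_slope_gt_ten (hb : Function.Injective b)
    (hoff : ∀ i j, j ≠ i → g i j = 0) (hmark : ∀ l, g (b l) (b l) = (2 : ℤ) ^ (l : ℕ)) (haux : ∀ i, (∀ l, b l ≠ i) → g i i = 0)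
    (M : Equiv.Perm V) (hM0 : M (b 0) ≠ b 0) (hM4 : M (b 4) ≠ b 4) (hs : 10 < ∑ i, g i (M i)) : M (b 2) = b 2 := by
  rw [slope_eq_sum_marked g b hb hoff hmark haux M, Fin.sum_univ_five] at hs
  by_contra c2
  by_cases c1 : M (b 1) = b 1 <;> by_cases c3 : M (b 3) = b 3 <;> simp [hM0, hM4, c1, c2, c3] at hs

/-- a cover missing the loops at `b0, b4` whose slope exceeds 6 uses the loop at `b3`. [folklore] -/
theorem fix_three_of_slope_gt_six (hb : Function.Injective b)
    (hoff : ∀ i j, j ≠ i → g i j = 0) (hmark : ∀ l, g (b l) (b l) = (2 : ℤ) ^ (l : ℕ)) (haux : ∀ i, (∀ l, b l ≠ i) → g i i = 0)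
    (M : Equiv.Perm V) (hM0 : M (b 0) ≠ b 0) (hM4 : M (b 4) ≠ b 4) (hs : 6 < ∑ i, g i (M i)) : M (b 3) = b 3 := by
  rw [slope_eq_sum_marked g b hb hoff hmark haux M, Fin.sum_univ_five] at hs
  by_contra c3
  by_cases c1 : M (b 1) = b 1 <;> by_cases c2 : M (b 2) = b 2 <;> simp [hM0, hM4, c1, c2, c3] at hs

/-- **Z-RIGIDITY in `σC ⊎ σE ⊎ σZ`.**  In any realisation of the core (any finite `V`), the only cover inside the arcs of `σC, σE, σZ` that
fixes both `b0` and `b4` is `σZ`. [this seat's lemma] -/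
theorem core_CEZ_unique (hb : Function.Injective b)
    (hoff : ∀ i j, j ≠ i → g i j = 0) (hmark : ∀ l, g (b l) (b l) = (2 : ℤ) ^ (l : ℕ)) (haux : ∀ i, (∀ l, b l ≠ i) → g i i = 0)
    {θC θE θZ : ℤ} {σC σE σZ : Equiv.Perm V} (hCE : θC < θE) (hEZ : θE < θZ)
    (hC : (∀ i, ok i (σC i)) ∧ ∀ τ : Equiv.Perm V, τ ≠ σC → (∀ i, ok i (τ i)) →
      ∑ i, (w i (τ i) + θC * g i (τ i)) < ∑ i, (w i (σC i) + θC * g i (σC i)))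
    (hE : (∀ i, ok i (σE i)) ∧ ∀ τ : Equiv.Perm V, τ ≠ σE → (∀ i, ok i (τ i)) →
      ∑ i, (w i (τ i) + θE * g i (τ i)) < ∑ i, (w i (σE i) + θE * g i (σE i)))
    (hZ : (∀ i, ok i (σZ i)) ∧ ∀ τ : Equiv.Perm V, τ ≠ σZ → (∀ i, ok i (τ i)) →
      ∑ i, (w i (τ i) + θZ * g i (τ i)) < ∑ i, (w i (σZ i) + θZ * g i (σZ i)))
    (hC0 : σC (b 0) ≠ b 0) (hC1 : σC (b 1) = b 1) (hC2 : σC (b 2) ≠ b 2) (hC3 : σC (b 3) = b 3) (hC4 : σC (b 4) ≠ b 4)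
    (hE0 : σE (b 0) ≠ b 0) (hE1 : σE (b 1) ≠ b 1) (hE2 : σE (b 2) = b 2) (hE3 : σE (b 3) = b 3) (hE4 : σE (b 4) ≠ b 4)
    (hZ0 : σZ (b 0) = b 0) (hZ1 : σZ (b 1) ≠ b 1) (hZ2 : σZ (b 2) ≠ b 2) (hZ3 : σZ (b 3) ≠ b 3) (hZ4 : σZ (b 4) = b 4)
    (T : Equiv.Perm V) (hT : ∀ i, T i = σC i ∨ T i = σE i ∨ T i = σZ i) (hT0 : T (b 0) = b 0) (hT4 : T (b 4) = b 4) :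
    T = σZ := by
  obtain ⟨M₂, M₃, hP⟩ := FourBit.two_factor σC σE σZ T hT
  have sC := slope_C g b hb hoff hmark haux σC hC0 hC1 hC2 hC3 hC4
  have sE := slope_E g b hb hoff hmark haux σE hE0 hE1 hE2 hE3 hE4
  have sZ := slope_Z g b hb hoff hmark haux σZ hZ0 hZ1 hZ2 hZ3 hZ4
  have sT := slope_ge_seventeen g b hb hoff hmark haux T hT0 hT4
  have hsum := FourBit.sum_eq_of_factorisation g hP
  rw [sC, sE, sZ] at hsum
  obtain ⟨n20, n30⟩ := not_fix_of_perm (hP (b 0)) hT0 hC0 hE0 hZ0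
  obtain ⟨n24, n34⟩ := not_fix_of_perm (hP (b 4)) hT4 hC4 hE4 hZ4
  have hhi : (∑ i, g i (σZ i)) ≤ ∑ i, g i (T i) := by rw [sZ]; exact sT
  -- one of the two other factors is low (pigeonhole on the loop at `b2`, present once outside `T`)
  have hlow : (∑ i, g i (M₂ i)) ≤ 10 ∨ (∑ i, g i (M₃ i)) ≤ 10 := by
    by_contra hcon
    push Not at hcon
    exact count_two_contra (hP (b 2)) (fix_two_of_slope_gt_ten g b hb hoff hmark haux M₂ n20 n24 hcon.1)
      (fix_two_of_slope_gt_ten g b hb hoff hmark haux M₃ n30 n34 hcon.2) hC2 hZ2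
  rcases hlow with h2 | h3
  · have hlo : (∑ i, g i (M₂ i)) ≤ ∑ i, g i (σC i) := by rw [sC]; exact h2
    exact (FourBit.factors_eq ok w g hCE hEZ hC hE hZ (fun i => perm_rotate (hP i)) hlo hhi).2.2
  · have hlo : (∑ i, g i (M₃ i)) ≤ ∑ i, g i (σC i) := by rw [sC]; exact h3
    exact (FourBit.factors_eq ok w g hCE hEZ hC hE hZ (fun i => perm_rotate' (hP i)) hlo hhi).2.2

/-- **Z-RIGIDITY in `σB ⊎ σE ⊎ σZ`.** [this seat's lemma] -/
theorem core_BEZ_unique (hb : Function.Injective b)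
    (hoff : ∀ i j, j ≠ i → g i j = 0) (hmark : ∀ l, g (b l) (b l) = (2 : ℤ) ^ (l : ℕ)) (haux : ∀ i, (∀ l, b l ≠ i) → g i i = 0)
    {θB θE θZ : ℤ} {σB σE σZ : Equiv.Perm V} (hBE : θB < θE) (hEZ : θE < θZ)
    (hB : (∀ i, ok i (σB i)) ∧ ∀ τ : Equiv.Perm V, τ ≠ σB → (∀ i, ok i (τ i)) →
      ∑ i, (w i (τ i) + θB * g i (τ i)) < ∑ i, (w i (σB i) + θB * g i (σB i)))
    (hE : (∀ i, ok i (σE i)) ∧ ∀ τ : Equiv.Perm V, τ ≠ σE → (∀ i, ok i (τ i)) →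
      ∑ i, (w i (τ i) + θE * g i (τ i)) < ∑ i, (w i (σE i) + θE * g i (σE i)))
    (hZ : (∀ i, ok i (σZ i)) ∧ ∀ τ : Equiv.Perm V, τ ≠ σZ → (∀ i, ok i (τ i)) →
      ∑ i, (w i (τ i) + θZ * g i (τ i)) < ∑ i, (w i (σZ i) + θZ * g i (σZ i)))
    (hB0 : σB (b 0) ≠ b 0) (hB1 : σB (b 1) = b 1) (hB2 : σB (b 2) = b 2) (hB3 : σB (b 3) ≠ b 3) (hB4 : σB (b 4) ≠ b 4)
    (hE0 : σE (b 0) ≠ b 0) (hE1 : σE (b 1) ≠ b 1) (hE2 : σE (b 2) = b 2) (hE3 : σE (b 3) = b 3) (hE4 : σE (b 4) ≠ b 4)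
    (hZ0 : σZ (b 0) = b 0) (hZ1 : σZ (b 1) ≠ b 1) (hZ2 : σZ (b 2) ≠ b 2) (hZ3 : σZ (b 3) ≠ b 3) (hZ4 : σZ (b 4) = b 4)
    (T : Equiv.Perm V) (hT : ∀ i, T i = σB i ∨ T i = σE i ∨ T i = σZ i) (hT0 : T (b 0) = b 0) (hT4 : T (b 4) = b 4) :
    T = σZ := by
  obtain ⟨M₂, M₃, hP⟩ := FourBit.two_factor σB σE σZ T hT
  have sB := slope_B g b hb hoff hmark haux σB hB0 hB1 hB2 hB3 hB4
  have sE := slope_E g b hb hoff hmark haux σE hE0 hE1 hE2 hE3 hE4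
  have sZ := slope_Z g b hb hoff hmark haux σZ hZ0 hZ1 hZ2 hZ3 hZ4
  have sT := slope_ge_seventeen g b hb hoff hmark haux T hT0 hT4
  obtain ⟨n20, n30⟩ := not_fix_of_perm (hP (b 0)) hT0 hB0 hE0 hZ0
  obtain ⟨n24, n34⟩ := not_fix_of_perm (hP (b 4)) hT4 hB4 hE4 hZ4
  have hhi : (∑ i, g i (σZ i)) ≤ ∑ i, g i (T i) := by rw [sZ]; exact sT
  have hlow : (∑ i, g i (M₂ i)) ≤ 6 ∨ (∑ i, g i (M₃ i)) ≤ 6 := by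
    by_contra hcon
    push Not at hcon
    exact count_two_contra (hP (b 3)) (fix_three_of_slope_gt_six g b hb hoff hmark haux M₂ n20 n24 hcon.1)
      (fix_three_of_slope_gt_six g b hb hoff hmark haux M₃ n30 n34 hcon.2) hB3 hZ3
  rcases hlow with h2 | h3
  · have hlo : (∑ i, g i (M₂ i)) ≤ ∑ i, g i (σB i) := by rw [sB]; exact h2
    exact (FourBit.factors_eq ok w g hBE hEZ hB hE hZ (fun i => perm_rotate (hP i)) hlo hhi).2.2
  · have hlo : (∑ i, g i (M₃ i)) ≤ ∑ i, g i (σB i) := by rw [sB]; exact h3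
    exact (FourBit.factors_eq ok w g hBE hEZ hB hE hZ (fun i => perm_rotate' (hP i)) hlo hhi).2.2

/-- **Z-RIGIDITY in `σB ⊎ σC ⊎ σZ`.** [this seat's lemma] -/
theorem core_BCZ_unique (hb : Function.Injective b)
    (hoff : ∀ i j, j ≠ i → g i j = 0) (hmark : ∀ l, g (b l) (b l) = (2 : ℤ) ^ (l : ℕ)) (haux : ∀ i, (∀ l, b l ≠ i) → g i i = 0)
    {θB θC θZ : ℤ} {σB σC σZ : Equiv.Perm V} (hBC : θB < θC) (hCZ : θC < θZ)
    (hB : (∀ i, ok i (σB i)) ∧ ∀ τ : Equiv.Perm V, τ ≠ σB → (∀ i, ok i (τ i)) →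
      ∑ i, (w i (τ i) + θB * g i (τ i)) < ∑ i, (w i (σB i) + θB * g i (σB i)))
    (hC : (∀ i, ok i (σC i)) ∧ ∀ τ : Equiv.Perm V, τ ≠ σC → (∀ i, ok i (τ i)) →
      ∑ i, (w i (τ i) + θC * g i (τ i)) < ∑ i, (w i (σC i) + θC * g i (σC i)))
    (hZ : (∀ i, ok i (σZ i)) ∧ ∀ τ : Equiv.Perm V, τ ≠ σZ → (∀ i, ok i (τ i)) →
      ∑ i, (w i (τ i) + θZ * g i (τ i)) < ∑ i, (w i (σZ i) + θZ * g i (σZ i)))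
    (hB0 : σB (b 0) ≠ b 0) (hB1 : σB (b 1) = b 1) (hB2 : σB (b 2) = b 2) (hB3 : σB (b 3) ≠ b 3) (hB4 : σB (b 4) ≠ b 4)
    (hC0 : σC (b 0) ≠ b 0) (hC1 : σC (b 1) = b 1) (hC2 : σC (b 2) ≠ b 2) (hC3 : σC (b 3) = b 3) (hC4 : σC (b 4) ≠ b 4)
    (hZ0 : σZ (b 0) = b 0) (hZ1 : σZ (b 1) ≠ b 1) (hZ2 : σZ (b 2) ≠ b 2) (hZ3 : σZ (b 3) ≠ b 3) (hZ4 : σZ (b 4) = b 4)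
    (T : Equiv.Perm V) (hT : ∀ i, T i = σB i ∨ T i = σC i ∨ T i = σZ i) (hT0 : T (b 0) = b 0) (hT4 : T (b 4) = b 4) :
    T = σZ := by
  obtain ⟨M₂, M₃, hP⟩ := FourBit.two_factor σB σC σZ T hT
  have sB := slope_B g b hb hoff hmark haux σB hB0 hB1 hB2 hB3 hB4
  have sC := slope_C g b hb hoff hmark haux σC hC0 hC1 hC2 hC3 hC4
  have sZ := slope_Z g b hb hoff hmark haux σZ hZ0 hZ1 hZ2 hZ3 hZ4
  have sT := slope_ge_seventeen g b hb hoff hmark haux T hT0 hT4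
  obtain ⟨n20, n30⟩ := not_fix_of_perm (hP (b 0)) hT0 hB0 hC0 hZ0
  obtain ⟨n24, n34⟩ := not_fix_of_perm (hP (b 4)) hT4 hB4 hC4 hZ4
  have hhi : (∑ i, g i (σZ i)) ≤ ∑ i, g i (T i) := by rw [sZ]; exact sT
  have hlow : (∑ i, g i (M₂ i)) ≤ 6 ∨ (∑ i, g i (M₃ i)) ≤ 6 := by
    by_contra hcon
    push Not at hcon
    exact count_two_contra (hP (b 3)) (fix_three_of_slope_gt_six g b hb hoff hmark haux M₂ n20 n24 hcon.1)
      (fix_three_of_slope_gt_six g b hb hoff hmark haux M₃ n30 n34 hcon.2) hB3 hZ3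
  rcases hlow with h2 | h3
  · have hlo : (∑ i, g i (M₂ i)) ≤ ∑ i, g i (σB i) := by rw [sB]; exact h2
    exact (FourBit.factors_eq ok w g hBC hCZ hB hC hZ (fun i => perm_rotate (hP i)) hlo hhi).2.2
  · have hlo : (∑ i, g i (M₃ i)) ≤ ∑ i, g i (σB i) := by rw [sB]; exact h3
    exact (FourBit.factors_eq ok w g hBC hCZ hB hC hZ (fun i => perm_rotate' (hP i)) hlo hhi).2.2

end Core

end Core
end MarkedEdge
end Summit.ValiantsHypothesis.ValiantsHypothesis.Theorems.KPlusLogSqLaw
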